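import Summits.BirchSwinnertonDyer.BirchSwinnertonDyer.Theorems.Rank2ObservatoryOrderCert
import HarnessLib

/-!
# BirchSwinnertonDyer — rank ≥ 2 observatory: rank-3 `p`-saturation, MATRIX form — witness primes

HONEST FRAMING: per-curve certified theorems and census instruments; no claim on BSD in rank ≥ 2.

KS4 (cert-2; designed g37, landed g38). Part 1 of the MATRIX (sieve) form of the odd-`p` saturation row
certificate — the form whose kernel cost does NOT grow with `p` (designed in the g36 memo §3, made
Hasse-free by `Rank2ObservatoryOrderCert.lean`; the row certificate is
`Rank2ObservatoryRank3PSatCertM.lean`). A WITNESS PRIME `q` carries a certified group order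
`N = p · k` (`#Ẽ(𝔽_q)`, by Euler count `killerLTB` OR by an ORDER CERTIFICATE `orderCertB`), a point
`R ∈ Ẽ(𝔽_q)` of exact order `p`, and the DISCRETE LOGARITHMS `dᵢ` with `k • P̃ᵢ = dᵢ • R`
(`i = 1, 2, 3`; each certified by two computed, `chainB`-validated chains). For an integer class
`(a, b, c)` with `s = a d₁ + b d₂ + c d₃ ≢ 0 (mod p)`: `k • (aP̃₁ + bP̃₂ + cP̃₃) = s • R ≠ O` while
`k • (p • Ẽ) = O`, so `aP₁ + bP₂ + cP₃ ∉ p•E(ℚ)` (`not_mem_pCoset_of_pWitnessM`). Three witnesses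
whose `3 × 3` matrix `(dᵢⱼ)` is invertible modulo `p` cover every class (adjugate identity,
`dvd_of_dvd_dots`), and the landed `listedSpan_saturated_of_not_mem_pCoset` gives `p`-saturation of
the listed span (`pSaturated_of_certPM`).

* `det3`, `dvd_of_dvd_dots` — the adjugate argument modulo `p` (pure `ℤ` arithmetic);
* `dlogCheckB` + `zsmul_eq_of_dlogCheckB` — `k • P̃ = d • R` from two validated chains
  (`d = 0`: `(k − 1) • P̃ = −P̃`);
* `PSatWitM` (one witness prime: `q, N`, optional order certificate, `R`, `d₁ d₂ d₃`),
  `PSatWitM.killer` (+ `killerB_of_killer`), `pWitnessMB` + `not_mem_pCoset_of_pWitnessM`;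
* `pSaturated_of_certPM` — the certificate on the scaled model.

Sorry-free; no `decide` is executed in this file (the Booleans are for data files).

References: S. Siksek, Rocky Mountain J. Math. 25 (1995) §3; M. Prickett, *Saturation of
Mordell–Weil groups of elliptic curves over number fields*, PhD thesis, Nottingham (2004);
J. E. Cremona, *Algorithms for Modular Elliptic Curves* (2nd ed. 1997) §3.5;
J. H. Silverman, AEC (2009) III.2.3, VII.3.
-/

-- single-conjunct summit: `Summit.BirchSwinnertonDyer.BirchSwinnertonDyer.…` repeats the name
set_option linter.dupNamespace false

namespace Summit.BirchSwinnertonDyer.BirchSwinnertonDyer.Rank2Observatory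

open WeierstrassCurve

/-! ### The adjugate argument modulo `p` -/

section Det

/-- The determinant of the `3 × 3` discrete-logarithm matrix `(dᵢⱼ)` (rows = listed generators,
columns = witness primes). [folklore] -/
def det3 (d₁₁ d₁₂ d₁₃ d₂₁ d₂₂ d₂₃ d₃₁ d₃₂ d₃₃ : ℤ) : ℤ :=
  d₁₁ * (d₂₂ * d₃₃ - d₂₃ * d₃₂) - d₁₂ * (d₂₁ * d₃₃ - d₂₃ * d₃₁) + d₁₃ * (d₂₁ * d₃₂ - d₂₂ * d₃₁)

/-- **Adjugate identity modulo `p`**: if `p ∤ det (dᵢⱼ)` and `p` divides all three column products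
`a d₁ⱼ + b d₂ⱼ + c d₃ⱼ`, then `p ∣ a, b, c` (`(a,b,c)·D·adj D = det · (a,b,c)`). [folklore] -/
theorem dvd_of_dvd_dots {p : ℕ} (hp : p.Prime) {d₁₁ d₁₂ d₁₃ d₂₁ d₂₂ d₂₃ d₃₁ d₃₂ d₃₃ : ℤ}
    (hdet : ¬ (p : ℤ) ∣ det3 d₁₁ d₁₂ d₁₃ d₂₁ d₂₂ d₂₃ d₃₁ d₃₂ d₃₃) {a b c : ℤ}
    (h₁ : (p : ℤ) ∣ a * d₁₁ + b * d₂₁ + c * d₃₁) (h₂ : (p : ℤ) ∣ a * d₁₂ + b * d₂₂ + c * d₃₂)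
    (h₃ : (p : ℤ) ∣ a * d₁₃ + b * d₂₃ + c * d₃₃) :
    (p : ℤ) ∣ a ∧ (p : ℤ) ∣ b ∧ (p : ℤ) ∣ c := by
  have hp' : Prime (p : ℤ) := Nat.prime_iff_prime_int.mp hp
  obtain ⟨t₁, ht₁⟩ := h₁
  obtain ⟨t₂, ht₂⟩ := h₂
  obtain ⟨t₃, ht₃⟩ := h₃
  have ea : a * det3 d₁₁ d₁₂ d₁₃ d₂₁ d₂₂ d₂₃ d₃₁ d₃₂ d₃₃ =
      (p : ℤ) * (t₁ * (d₂₂ * d₃₃ - d₂₃ * d₃₂) - t₂ * (d₂₁ * d₃₃ - d₂₃ * d₃₁)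
        + t₃ * (d₂₁ * d₃₂ - d₂₂ * d₃₁)) := by
    unfold det3
    linear_combination (d₂₂ * d₃₃ - d₂₃ * d₃₂) * ht₁ - (d₂₁ * d₃₃ - d₂₃ * d₃₁) * ht₂
      + (d₂₁ * d₃₂ - d₂₂ * d₃₁) * ht₃
  have eb : b * det3 d₁₁ d₁₂ d₁₃ d₂₁ d₂₂ d₂₃ d₃₁ d₃₂ d₃₃ =
      (p : ℤ) * (-(t₁ * (d₁₂ * d₃₃ - d₁₃ * d₃₂)) + t₂ * (d₁₁ * d₃₃ - d₁₃ * d₃₁)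
        - t₃ * (d₁₁ * d₃₂ - d₁₂ * d₃₁)) := by
    unfold det3
    linear_combination -(d₁₂ * d₃₃ - d₁₃ * d₃₂) * ht₁ + (d₁₁ * d₃₃ - d₁₃ * d₃₁) * ht₂
      - (d₁₁ * d₃₂ - d₁₂ * d₃₁) * ht₃
  have ec : c * det3 d₁₁ d₁₂ d₁₃ d₂₁ d₂₂ d₂₃ d₃₁ d₃₂ d₃₃ =
      (p : ℤ) * (t₁ * (d₁₂ * d₂₃ - d₁₃ * d₂₂) - t₂ * (d₁₁ * d₂₃ - d₁₃ * d₂₁)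
        + t₃ * (d₁₁ * d₂₂ - d₁₂ * d₂₁)) := by
    unfold det3
    linear_combination (d₁₂ * d₂₃ - d₁₃ * d₂₂) * ht₁ - (d₁₁ * d₂₃ - d₁₃ * d₂₁) * ht₂
      + (d₁₁ * d₂₂ - d₁₂ * d₂₁) * ht₃
  refine ⟨?_, ?_, ?_⟩
  · exact ((hp'.dvd_or_dvd (Dvd.intro _ ea.symm)).resolve_right hdet)
  · exact ((hp'.dvd_or_dvd (Dvd.intro _ eb.symm)).resolve_right hdet)
  · exact ((hp'.dvd_or_dvd (Dvd.intro _ ec.symm)).resolve_right hdet)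

end Det

/-! ### Discrete logarithms by computed chains -/

section DLog

variable (V : WeierstrassCurve ℤ) (q : ℕ)

/-- DISCRETE-LOGARITHM CHECK `k • P = d • R` in `Ẽ(𝔽_q)` (a Boolean for `decide`): for `d = 0`
the certified multiple `(k − 1) • P` is `−P`; otherwise the certified multiples `k • P` and `d • R`
are both affine and equal. [cite: SilvermanAEC2009, III.2.3] -/
def dlogCheckB [NeZero q] (xR yR xP yP : ZMod q) (k d : ℕ) : Bool :=
  if d = 0 then
    decide (multPointC V q (xP, yP) (k - 1) =
      some (xP, -yP - (V.a₁ : ZMod q) * xP - (V.a₃ : ZMod q)))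
  else
    match multPointC V q (xP, yP) k, multPointC V q (xR, yR) d with
    | some A, some B => decide (A = B)
    | _, _ => false

variable [Fact q.Prime]

/-- Soundness of `dlogCheckB`: `k • P = d • R` (as `ℤ`-multiples).
[cite: SilvermanAEC2009, III.2.3] -/
theorem zsmul_eq_of_dlogCheckB {xR yR xP yP : ZMod q}
    (hR : (V.map (Int.castRingHom (ZMod q))).toAffine.Nonsingular xR yR)
    (hP : (V.map (Int.castRingHom (ZMod q))).toAffine.Nonsingular xP yP) {k d : ℕ} (hk : 0 < k)
    (h : dlogCheckB V q xR yR xP yP k d = true) :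
    (k : ℤ) • (Affine.Point.some xP yP hP : (V.map (Int.castRingHom (ZMod q))).toAffine.Point) =
      (d : ℤ) •
        (Affine.Point.some xR yR hR : (V.map (Int.castRingHom (ZMod q))).toAffine.Point) := by
  unfold dlogCheckB at h
  by_cases hd : d = 0
  · rw [if_pos hd, decide_eq_true_eq] at h
    obtain ⟨hN, eN⟩ := exists_nsmul_eq_of_multPointC V q (g := (xP, yP)) hP h
    have hneg : -(Affine.Point.some xP yP hP : (V.map (Int.castRingHom (ZMod q))).toAffine.Point) =
        .some xP (-yP - (V.a₁ : ZMod q) * xP - (V.a₃ : ZMod q)) hN := by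
      rw [Affine.Point.neg_some]
      congr 1
    have hk1 : (k - 1) • (Affine.Point.some xP yP hP :
        (V.map (Int.castRingHom (ZMod q))).toAffine.Point) = -(Affine.Point.some xP yP hP) := by
      rw [hneg]; exact eN
    have hk0 : k • (Affine.Point.some xP yP hP :
        (V.map (Int.castRingHom (ZMod q))).toAffine.Point) = 0 := by
      have : k = (k - 1) + 1 := by omega
      rw [this, succ_nsmul, hk1, neg_add_cancel]
    rw [hd, natCast_zsmul, hk0, Nat.cast_zero, zero_zsmul]
  · rw [if_neg hd] at h
    split at h
    · rename_i A B hA hB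
      rw [decide_eq_true_eq] at h
      subst h
      obtain ⟨hA', eA⟩ := exists_nsmul_eq_of_multPointC V q (g := (xP, yP)) hP hA
      obtain ⟨hB', eB⟩ := exists_nsmul_eq_of_multPointC V q (g := (xR, yR)) hR hB
      rw [natCast_zsmul, natCast_zsmul]
      exact eA.trans eB.symm
    · exact absurd h Bool.false_ne_true

end DLog

/-! ### One witness prime -/

section Witness

/-- ONE WITNESS PRIME of the matrix form: the prime `q`, the group order `N = #Ẽ(𝔽_q)`, an optional
ORDER CERTIFICATE `(X, Y, factorisation)` for `N` (`none`: Euler count), a point `R = (xR, yR)` of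
order `p`, and the discrete logarithms `dᵢ` with `(N / p) • P̃ᵢ = dᵢ • R`.
[cite: CremonaAlgorithms1997, §3.5] -/
structure PSatWitM where
  /-- the witness prime -/
  q : ℕ
  /-- the group order `#Ẽ(𝔽_q)` -/
  N : ℕ
  /-- optional order certificate `(X, Y, [(r, e), …])` for `N` (`none` = Euler count) -/
  oc : Option (ℤ × ℤ × List (ℕ × ℕ))
  /-- `x`-coordinate of the point `R` of order `p` -/
  xR : ℤ
  /-- `y`-coordinate of the point `R` of order `p` -/
  yR : ℤ
  /-- discrete logarithm of the first generator -/
  d₁ : ℕ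
  /-- discrete logarithm of the second generator -/
  d₂ : ℕ
  /-- discrete logarithm of the third generator -/
  d₃ : ℕ

/-- The killer of a witness prime: Euler count (`killerLTB`) or order certificate (`orderCertB`).
[cite: CremonaAlgorithms1997, §2.4] -/
def PSatWitM.killer (V : WeierstrassCurve ℤ) (w : PSatWitM) : Bool :=
  match w.oc with
  | none => killerLTB V (w.q, w.N)
  | some (X, Y, fs) => orderCertB V (w.q, w.N, X, Y, fs)

/-- Either killer gives the landed `killerB`. [folklore] -/
theorem PSatWitM.killerB_of_killer (V : WeierstrassCurve ℤ) (w : PSatWitM)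
    (h : w.killer V = true) : killerB V (w.q, w.N) = true := by
  unfold PSatWitM.killer at h
  split at h
  · exact killerB_of_killerLB V (killerLB_of_killerLTB V h)
  · exact killerB_of_orderCertB V h

/-- The witness Boolean at the prime `q` (explicit for the `ZMod q` casts): `N = p · k` with
`0 < k`, `R` on `V mod q`, `(p − 1) • R = −R`, and the three discrete-logarithm checks.
[cite: CremonaAlgorithms1997, §3.5] -/
def pWitnessMAux (V : WeierstrassCurve ℤ) (p : ℕ) (X₁ Y₁ X₂ Y₂ X₃ Y₃ : ℤ) (w : PSatWitM) :
    ℕ → Bool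
  | 0 => false
  | q + 1 =>
    decide (w.N = p * (w.N / p) ∧ 0 < w.N / p) &&
    decide ((w.yR : ZMod (q + 1)) ^ 2 + (V.a₁ : ZMod (q + 1)) * w.xR * w.yR
        + (V.a₃ : ZMod (q + 1)) * w.yR =
      (w.xR : ZMod (q + 1)) ^ 3 + (V.a₂ : ZMod (q + 1)) * w.xR ^ 2 + (V.a₄ : ZMod (q + 1)) * w.xR
        + (V.a₆ : ZMod (q + 1))) &&
    decide (multPointC V (q + 1) ((w.xR : ZMod (q + 1)), (w.yR : ZMod (q + 1))) (p - 1) =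
      some ((w.xR : ZMod (q + 1)),
        -(w.yR : ZMod (q + 1)) - (V.a₁ : ZMod (q + 1)) * w.xR - (V.a₃ : ZMod (q + 1)))) &&
    dlogCheckB V (q + 1) w.xR w.yR X₁ Y₁ (w.N / p) w.d₁ &&
    dlogCheckB V (q + 1) w.xR w.yR X₂ Y₂ (w.N / p) w.d₂ &&
    dlogCheckB V (q + 1) w.xR w.yR X₃ Y₃ (w.N / p) w.d₃

/-- The witness Boolean of the matrix form for the integral points `(Xᵢ, Yᵢ)`.
[cite: CremonaAlgorithms1997, §3.5] -/
def pWitnessMB (V : WeierstrassCurve ℤ) (p : ℕ) (X₁ Y₁ X₂ Y₂ X₃ Y₃ : ℤ) (w : PSatWitM) : Bool :=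
  pWitnessMAux V p X₁ Y₁ X₂ Y₂ X₃ Y₃ w w.q

open scoped Classical in
/-- **Soundness of one witness prime**: if `p ∤ a d₁ + b d₂ + c d₃` then
`aP₁ + bP₂ + cP₃ ∉ p•E'(ℚ)` for the integral points `Pᵢ = (Xᵢ, Yᵢ)` of `E' = V`: the reduction
`y = aP̃₁ + bP̃₂ + cP̃₃` has `k • y = (a d₁ + b d₂ + c d₃) • R ≠ O` (`R` of exact order `p`), while
`k • (p • Ẽ(𝔽_q)) = O`. [cite: SilvermanAEC2009, VII.3] [cite: CremonaAlgorithms1997, §3.5] -/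
theorem not_mem_pCoset_of_pWitnessM (V : WeierstrassCurve ℤ) (hΔ : V.Δ ≠ 0) {p : ℕ}
    (hp : p.Prime) {w : PSatWitM} (hqN : killerB V (w.q, w.N) = true) {X₁ Y₁ X₂ Y₂ X₃ Y₃ : ℤ}
    (e₁ : Y₁ ^ 2 + V.a₁ * X₁ * Y₁ + V.a₃ * Y₁ = X₁ ^ 3 + V.a₂ * X₁ ^ 2 + V.a₄ * X₁ + V.a₆)
    (e₂ : Y₂ ^ 2 + V.a₁ * X₂ * Y₂ + V.a₃ * Y₂ = X₂ ^ 3 + V.a₂ * X₂ ^ 2 + V.a₄ * X₂ + V.a₆)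
    (e₃ : Y₃ ^ 2 + V.a₁ * X₃ * Y₃ + V.a₃ * Y₃ = X₃ ^ 3 + V.a₂ * X₃ ^ 2 + V.a₄ * X₃ + V.a₆)
    (hw : pWitnessMB V p X₁ Y₁ X₂ Y₂ X₃ Y₃ w = true) {a b c : ℤ}
    (hs : ¬ (p : ℤ) ∣ a * w.d₁ + b * w.d₂ + c * w.d₃) :
    a • (Affine.Point.some (X₁ : ℚ) (Y₁ : ℚ) (nonsingular_rat_of_eq V hΔ e₁) :
        (V.map (Int.castRingHom ℚ)).toAffine.Point)
      + b • Affine.Point.some (X₂ : ℚ) (Y₂ : ℚ) (nonsingular_rat_of_eq V hΔ e₂)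
      + c • Affine.Point.some (X₃ : ℚ) (Y₃ : ℚ) (nonsingular_rat_of_eq V hΔ e₃) ∉
      pCoset (V.map (Int.castRingHom ℚ)).toAffine.Point p 0 := by
  obtain ⟨q, N, oc, xR, yR, d₁, d₂, d₃⟩ := w
  cases q with
  | zero => simp [pWitnessMB, pWitnessMAux] at hw
  | succ q =>
    dsimp only at hqN hs
    obtain ⟨hprime, hq, hcount⟩ := killerB_sound V hqN
    haveI : Fact (q + 1).Prime := ⟨hprime⟩
    haveI : Fact p.Prime := ⟨hp⟩
    simp only [pWitnessMB, pWitnessMAux, Bool.and_eq_true, decide_eq_true_eq] at hw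
    obtain ⟨⟨⟨⟨⟨⟨hNk, hkpos⟩, heR⟩, hRp⟩, hd₁⟩, hd₂⟩, hd₃⟩ := hw
    set k := N / p with hk
    -- the point `R` of order `p`
    set W := V.map (Int.castRingHom (ZMod (q + 1))) with hW
    have hER : W.toAffine.Equation (xR : ZMod (q + 1)) (yR : ZMod (q + 1)) := by
      rw [Affine.equation_iff]
      simpa [hW, WeierstrassCurve.map] using heR
    have hR : W.toAffine.Nonsingular (xR : ZMod (q + 1)) (yR : ZMod (q + 1)) :=
      (Affine.equation_iff_nonsingular_of_Δ_ne_zero (Δ_zmod_ne_zero V (q + 1) hq)).mp hER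
    set R : W.toAffine.Point := .some _ _ hR with hRdef
    obtain ⟨hRn, eRn⟩ := exists_nsmul_eq_of_multPointC V (q + 1)
      (g := ((xR : ZMod (q + 1)), (yR : ZMod (q + 1)))) hR hRp
    have hnegR : -R = .some (xR : ZMod (q + 1))
        (-(yR : ZMod (q + 1)) - (V.a₁ : ZMod (q + 1)) * xR - (V.a₃ : ZMod (q + 1))) hRn := by
      rw [hRdef, Affine.Point.neg_some]
      congr 1
    have hp1 : (p - 1) • R = -R := by rw [hnegR]; exact eRn
    have hpR : p • R = 0 := by
      have : p = (p - 1) + 1 := by have := hp.two_le; omega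
      rw [this, succ_nsmul, hp1, neg_add_cancel]
    have hord : addOrderOf R = p := addOrderOf_eq_prime hpR (Affine.Point.some_ne_zero _)
    -- the reductions of the generators and their discrete logarithms
    have E₁ : V.toAffine.Equation X₁ Y₁ := (Affine.equation_iff X₁ Y₁).mpr e₁
    have E₂ : V.toAffine.Equation X₂ Y₂ := (Affine.equation_iff X₂ Y₂).mpr e₂
    have E₃ : V.toAffine.Equation X₃ Y₃ := (Affine.equation_iff X₃ Y₃).mpr e₃
    have hk₁ := zsmul_eq_of_dlogCheckB V (q + 1) hR (nonsingular_zmod_of_equation V (q + 1) hq E₁)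
      hkpos hd₁
    have hk₂ := zsmul_eq_of_dlogCheckB V (q + 1) hR (nonsingular_zmod_of_equation V (q + 1) hq E₂)
      hkpos hd₂
    have hk₃ := zsmul_eq_of_dlogCheckB V (q + 1) hR (nonsingular_zmod_of_equation V (q + 1) hq E₃)
      hkpos hd₃
    -- pull back along the reduction map
    refine not_mem_pCoset_of_map_not_mem (reduceMod V (q + 1) hq) ?_
    rw [map_add, map_add, map_zsmul, map_zsmul, map_zsmul, reduceMod_some V (q + 1) hq E₁,
      reduceMod_some V (q + 1) hq E₂, reduceMod_some V (q + 1) hq E₃]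
    refine not_mem_pCoset_zero_of_nsmul_ne_zero (k := k) (fun y => ?_) ?_
    · rw [← hNk, ← hcount, ← natCard_point_eq_zmodPointCount V (q + 1) hq]
      exact card_nsmul_eq_zero'
    · rw [← natCast_zsmul]
      have e : (k : ℤ) • (a • (Affine.Point.some (X₁ : ZMod (q + 1)) (Y₁ : ZMod (q + 1))
              (nonsingular_zmod_of_equation V (q + 1) hq E₁) : W.toAffine.Point)
            + b • Affine.Point.some (X₂ : ZMod (q + 1)) (Y₂ : ZMod (q + 1))
              (nonsingular_zmod_of_equation V (q + 1) hq E₂)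
            + c • Affine.Point.some (X₃ : ZMod (q + 1)) (Y₃ : ZMod (q + 1))
              (nonsingular_zmod_of_equation V (q + 1) hq E₃)) =
          a • ((k : ℤ) • Affine.Point.some (X₁ : ZMod (q + 1)) (Y₁ : ZMod (q + 1))
              (nonsingular_zmod_of_equation V (q + 1) hq E₁))
            + b • ((k : ℤ) • Affine.Point.some (X₂ : ZMod (q + 1)) (Y₂ : ZMod (q + 1))
              (nonsingular_zmod_of_equation V (q + 1) hq E₂))
            + c • ((k : ℤ) • Affine.Point.some (X₃ : ZMod (q + 1)) (Y₃ : ZMod (q + 1))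
              (nonsingular_zmod_of_equation V (q + 1) hq E₃)) := by
        module
      rw [e, hk₁, hk₂, hk₃]
      have e2 : a • ((d₁ : ℤ) • R) + b • ((d₂ : ℤ) • R) + c • ((d₃ : ℤ) • R) =
          (a * d₁ + b * d₂ + c * d₃) • R := by
        module
      rw [e2]
      intro h0
      apply hs
      have hdvd := addOrderOf_dvd_iff_zsmul_eq_zero.mpr h0
      rwa [hord] at hdvd

end Witness

/-! ### The certificate on the scaled model, matrix form -/

section Model

open scoped Classical in
/-- **`p`-saturation on the integral model from the MATRIX certificate**: three witness primes
whose discrete-logarithm matrix is invertible modulo `p`. [cite: CremonaAlgorithms1997, §3.5] -/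
theorem pSaturated_of_certPM (V : WeierstrassCurve ℤ) (hΔ : V.Δ ≠ 0) {X₁ Y₁ X₂ Y₂ X₃ Y₃ : ℤ}
    (e₁ : Y₁ ^ 2 + V.a₁ * X₁ * Y₁ + V.a₃ * Y₁ = X₁ ^ 3 + V.a₂ * X₁ ^ 2 + V.a₄ * X₁ + V.a₆)
    (e₂ : Y₂ ^ 2 + V.a₁ * X₂ * Y₂ + V.a₃ * Y₂ = X₂ ^ 3 + V.a₂ * X₂ ^ 2 + V.a₄ * X₂ + V.a₆)
    (e₃ : Y₃ ^ 2 + V.a₁ * X₃ * Y₃ + V.a₃ * Y₃ = X₃ ^ 3 + V.a₂ * X₃ ^ 2 + V.a₄ * X₃ + V.a₆)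
    {p : ℕ} (hp : p.Prime) {S : List (ℕ × ℕ)} {t : ℕ}
    (hS : ∀ ℓN ∈ S, ℓN.1.Prime ∧
      ∀ (x : (V.map (Int.castRingHom ℚ)).toAffine.Point) (n : ℕ), ¬ ℓN.1 ∣ n → n • x = 0 →
        ℓN.2 • x = 0)
    (ht : annihilatorCheck S t = true) (hpt : ¬ (p : ℤ) ∣ (t : ℤ)) {w₁ w₂ w₃ : PSatWitM}
    (hq₁ : killerB V (w₁.q, w₁.N) = true) (hq₂ : killerB V (w₂.q, w₂.N) = true)
    (hq₃ : killerB V (w₃.q, w₃.N) = true)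
    (hw₁ : pWitnessMB V p X₁ Y₁ X₂ Y₂ X₃ Y₃ w₁ = true)
    (hw₂ : pWitnessMB V p X₁ Y₁ X₂ Y₂ X₃ Y₃ w₂ = true)
    (hw₃ : pWitnessMB V p X₁ Y₁ X₂ Y₂ X₃ Y₃ w₃ = true)
    (hdet : ¬ (p : ℤ) ∣ det3 w₁.d₁ w₂.d₁ w₃.d₁ w₁.d₂ w₂.d₂ w₃.d₂ w₁.d₃ w₂.d₃ w₃.d₃) :
    ∀ x : (V.map (Int.castRingHom ℚ)).toAffine.Point,
      p • x ∈ AddSubgroup.closure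
          {Affine.Point.some (X₁ : ℚ) (Y₁ : ℚ) (nonsingular_rat_of_eq V hΔ e₁),
            Affine.Point.some (X₂ : ℚ) (Y₂ : ℚ) (nonsingular_rat_of_eq V hΔ e₂),
            Affine.Point.some (X₃ : ℚ) (Y₃ : ℚ) (nonsingular_rat_of_eq V hΔ e₃)} ⊔
          AddCommGroup.torsion _ →
      x ∈ AddSubgroup.closure
          {Affine.Point.some (X₁ : ℚ) (Y₁ : ℚ) (nonsingular_rat_of_eq V hΔ e₁),
            Affine.Point.some (X₂ : ℚ) (Y₂ : ℚ) (nonsingular_rat_of_eq V hΔ e₂),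
            Affine.Point.some (X₃ : ℚ) (Y₃ : ℚ) (nonsingular_rat_of_eq V hΔ e₃)} ⊔
          AddCommGroup.torsion _ := by
  refine listedSpan_saturated_of_not_mem_pCoset hp (u := 0) (m := (t : ℤ))
    (isCoprime_of_prime_of_not_dvd hp hpt) ?_ ?_
  · intro x hx
    rw [pow_zero, one_mul, natCast_zsmul]
    exact nsmul_eq_zero_of_annihilatorCheck hS ht hx
  · intro a b c ha ha' hb hb' hc hc' hne
    have hdiv : ¬ ((p : ℤ) ∣ a ∧ (p : ℤ) ∣ b ∧ (p : ℤ) ∣ c) := by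
      rintro ⟨hpa, hpb, hpc⟩
      exact hne ⟨Int.eq_zero_of_dvd_of_nonneg_of_lt ha ha' hpa,
        Int.eq_zero_of_dvd_of_nonneg_of_lt hb hb' hpb,
        Int.eq_zero_of_dvd_of_nonneg_of_lt hc hc' hpc⟩
    by_cases hs₁ : (p : ℤ) ∣ a * w₁.d₁ + b * w₁.d₂ + c * w₁.d₃
    · by_cases hs₂ : (p : ℤ) ∣ a * w₂.d₁ + b * w₂.d₂ + c * w₂.d₃
      · by_cases hs₃ : (p : ℤ) ∣ a * w₃.d₁ + b * w₃.d₂ + c * w₃.d₃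
        · exact absurd (dvd_of_dvd_dots hp hdet hs₁ hs₂ hs₃) hdiv
        · exact not_mem_pCoset_of_pWitnessM V hΔ hp hq₃ e₁ e₂ e₃ hw₃ hs₃
      · exact not_mem_pCoset_of_pWitnessM V hΔ hp hq₂ e₁ e₂ e₃ hw₂ hs₂
    · exact not_mem_pCoset_of_pWitnessM V hΔ hp hq₁ e₁ e₂ e₃ hw₁ hs₁

end Model

end Summit.BirchSwinnertonDyer.BirchSwinnertonDyer.Rank2Observatory
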